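import Literature.AlgebraicGeometry.Frobenioids.RationalFunctionSubfunctors
import Literature.AlgebraicGeometry.Frobenioids.RealificationRPowWeak
import Literature.AnabelianGeometry.EtaleTheta.RealificationFunctorWeak
import HarnessLib

/-!
# Frobenioids I, Def. 2.4 (i) / Prop. 5.3: THE realification data `(Φ^rlf, Φ^pf → Φ^rlf, ℝ ↷ (Φ^rlf)^gp)`
# of a monoid `Φ` on a category with WEAKLY perf-factorial values (cofinal perfections)

Mochizuki, *The geometry of Frobenioids I*, Kyushu J. Math. **62** (2008), §2, Definition 2.4 (i) p. 48
("`(M^rlf)^gp ⊆ (M^rlf_factor)^gp = ∏_{𝔭 ∈ Prime(M)} (M^rlf_𝔭)^gp` is an `ℝ`-vector space") and §5,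
Proposition 5.3 p. 103 ("the divisor monoid `Φ^rlf` [i.e., the 'realification' of Definition 2.4, (i)] and
the rational function monoid `ℝ · Φ^birat ⊆ (Φ^rlf)^gp` [i.e., for `A_D ∈ Ob(D)`, `(ℝ · Φ^birat)(A_D)` is the
`ℝ`-vector subspace of `(Φ^rlf)^gp(A_D)` generated by `Φ^birat(A_D)`]")
[cite: MochizukiFrdI2008, Def. 2.4(i) p.48] [cite: MochizukiFrdI2008, Prop. 5.3 p.103]; consumed by
[MochizukiEtTh2009] Def. 3.6 (i) p. 76 ("`Φ₀^ℝ := Φ₀^rlf`", "`ℝ·Φ₀^cnst ⊆ (Φ₀^ℝ)^gp`").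

WEAK-HYPOTHESIS TWIN of `RealificationDataCanonical.lean` (seat abc-iut-L1-d2): the tree's interface
`structure RealificationData Φ` (`RationalFunctionSubfunctors.lean`: `rlf`, `pfToRlf : Φ^pf ⟶ Φ^rlf`, the
`ℝ`-action `rsmul` on the `(Φ^rlf(X))^gp` with its laws, `ℝ`-linear pull-backs) parametrises everything
realified downstream (`R.realSpan Ψ = ℝ · Ψ`, `C^rlf`, [EtTh] Def. 3.6 `ℝ · Φ₀^cnst`); its instance
`RealificationData.canonical Φ hΦ` needs PRINTED perf-factorial values, which fails for the divisor
monoids `Φ₀(Y^log) ⊇ ∏_j ℤ_{≥0}` of [EtTh] §3 at coverings with infinitely many special-fibre components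
(cell finding F-L2d2-1).  THIS FILE constructs the instance for values that are weakly perf-factorial
with cofinal perfection (`IsPerfFactorialCof`, the cell's repaired reading of [EtTh] Prop. 3.4 (i);
F-L2d2-2): `rlf :=` the weak realification functor `rlfFunctorWeak Φ hΦ` (`RealificationFunctorWeak.lean`),
`pfToRlf :=` the factorization homomorphisms, `rsmul :=` the `ℝ`-vector-space structure
`IsPerfFactorialWeak.Rlf.realSMul` (`RealificationRPowWeak.lean`), `ℝ`-linear pull-backs by
`IsPerfFactorialWeak.Rlf.map_realSMul`:

* `RealificationData.pfToRlfNatTransWeak Φ hΦ : Φ^pf ⟶ Φ^rlf`;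
* **`RealificationData.canonicalWeak Φ hΦ : RealificationData Φ`**, with `canonicalWeak_rlf/_pfToRlf/_rsmul`,
  `canonicalWeak_rsmul_coe_of`, `canonicalWeak_toRlf : (canonicalWeak Φ hΦ).toRlf = toRlfNatTransWeak Φ hΦ`.

No statement of the paper is re-typed; this instantiates an existing interface.  Seat abc-iut-L6-t12
(cell abc-iut; F-L2d2-1 / F-L2d2-2 repair chain, split with abc-iut-L2-d2 2026-08-26T03:42Z, piece (D)).
HONEST FRAMING: classical monoid algebra; nothing here bears on [IUTchIII] Cor. 3.12.
-/

noncomputable section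

namespace Literature.AlgebraicGeometry.Frobenioids

open CategoryTheory Opposite Function Literature.AnabelianGeometry.EtaleTheta

universe w v u

namespace RealificationData

variable {D : Type u} [Category.{v} D] (Φ : Dᵒᵖ ⥤ CommMonCat.{w})
  (hΦ : ∀ X : Dᵒᵖ, IsPerfFactorialCof (Φ.obj X))

/-- **`Φ^pf ⟶ Φ^rlf`** (weak values), the natural transformation with components the factorization
homomorphisms `Φ(X)^pf → Φ(X)^rlf` (Def. 2.4 (i)(c)); naturality is the defining property of
`Φ^rlf(f) = rlfMapWeak` (`rlfMapWeak_comp_toRealification`). [cite: MochizukiFrdI2008, Prop. 5.3 p.103] -/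
def pfToRlfNatTransWeak : perfectionFunctor Φ ⟶ rlfFunctorWeak Φ hΦ where
  app X := CommMonCat.ofHom (hΦ X).weak.toRealification
  naturality X Y f := by
    apply CommMonCat.hom_ext
    change (hΦ Y).weak.toRealification.comp (Perfection.map (Φ.map f).hom) =
      (rlfMapWeak Φ hΦ f).comp (hΦ X).weak.toRealification
    exact (rlfMapWeak_comp_toRealification Φ hΦ f).symm

/-- Components of `Φ^pf ⟶ Φ^rlf` (weak values). [cite: MochizukiFrdI2008, Prop. 5.3 p.103] -/
@[simp] theorem pfToRlfNatTransWeak_app_hom (X : Dᵒᵖ) :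
    ((pfToRlfNatTransWeak Φ hΦ).app X).hom = (hΦ X).weak.toRealification := rfl

/-- **THE realification data `(Φ^rlf, Φ^pf → Φ^rlf, ℝ ↷ (Φ^rlf)^gp)`** of a monoid `Φ` on `D` with weakly
perf-factorial values with cofinal perfections (Prop. 5.3: "the divisor monoid `Φ^rlf`"): the instance of
the interface `RealificationData Φ` with `rlf := Φ^rlf = rlfFunctorWeak Φ hΦ`, `pfToRlf :=` the
factorization homomorphisms, `rsmul :=` the `ℝ`-vector-space structure `realSMul` of the `(Φ(X)^rlf)^gp`,
whose pull-backs are `ℝ`-linear by `map_realSMul`. [cite: MochizukiFrdI2008, Prop. 5.3 p.103] -/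
def canonicalWeak : RealificationData Φ where
  rlf := rlfFunctorWeak Φ hΦ
  pfToRlf := pfToRlfNatTransWeak Φ hΦ
  rsmul X r := IsPerfFactorialWeak.Rlf.realSMul (hΦ (op X)).weak r
  rsmul_add X r s x := IsPerfFactorialWeak.Rlf.realSMul_add (hΦ (op X)).weak r s x
  rsmul_mul X r s x := IsPerfFactorialWeak.Rlf.realSMul_mul (hΦ (op X)).weak r s x
  rsmul_one X x := IsPerfFactorialWeak.Rlf.realSMul_one (hΦ (op X)).weak x
  pullGp_rsmul f r x :=
    IsPerfFactorialWeak.Rlf.map_realSMul (hΦ (op _)).weak (hΦ (op _)).weak (rlfMapWeak Φ hΦ f.op) r x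

/-- `(canonicalWeak Φ hΦ).rlf = Φ^rlf` (weak). [cite: MochizukiFrdI2008, Prop. 5.3 p.103] -/
@[simp] theorem canonicalWeak_rlf : (canonicalWeak Φ hΦ).rlf = rlfFunctorWeak Φ hΦ := rfl

/-- `(canonicalWeak Φ hΦ).pfToRlf` is `Φ^pf ⟶ Φ^rlf`. [cite: MochizukiFrdI2008, Prop. 5.3 p.103] -/
@[simp] theorem canonicalWeak_pfToRlf : (canonicalWeak Φ hΦ).pfToRlf = pfToRlfNatTransWeak Φ hΦ := rfl

/-- `(canonicalWeak Φ hΦ).rsmul X r` is the `ℝ`-vector-space structure `realSMul` of `(Φ(X)^rlf)^gp`.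
[cite: MochizukiFrdI2008, Prop. 5.3 p.103] -/
@[simp] theorem canonicalWeak_rsmul (X : D) (r : ℝ) :
    (canonicalWeak Φ hΦ).rsmul X r = IsPerfFactorialWeak.Rlf.realSMul (hΦ (op X)).weak r := rfl

/-- For `r ≥ 0` the action on `[a]`, `a ∈ Φ(X)^rlf`, is the power: `r • [a] = [a^r]`.
[cite: MochizukiFrdI2008, Prop. 5.3 p.103] -/
theorem canonicalWeak_rsmul_coe_of (X : D) (r : NNReal) (a : (hΦ (op X)).weak.Rlf) :
    (canonicalWeak Φ hΦ).rsmul X (r : ℝ) (Algebra.GrothendieckGroup.of a) =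
      Algebra.GrothendieckGroup.of (IsPerfFactorialWeak.Rlf.rpow (hΦ (op X)).weak r a) :=
  IsPerfFactorialWeak.Rlf.realSMul_coe_of (hΦ (op X)).weak r a

/-- **The natural map `Φ → Φ^rlf` of THE weak realification data is `Φ → Φ^pf → Φ^rlf`** (= the natural
transformation `toRlfNatTransWeak` of `RealificationFunctorWeak.lean`). [cite: MochizukiFrdI2008, Prop. 5.3 p.103] -/
theorem canonicalWeak_toRlf : (canonicalWeak Φ hΦ).toRlf = toRlfNatTransWeak Φ hΦ := by
  ext X : 2
  rfl

/-- Components of `Φ → Φ^rlf` for THE weak realification data: `a ↦` (factorization of the image of `a`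
in `Φ(X)^pf`). [cite: MochizukiFrdI2008, Prop. 5.3 p.103] -/
theorem canonicalWeak_toRlf_app_hom (X : Dᵒᵖ) (a : Φ.obj X) :
    ((canonicalWeak Φ hΦ).toRlf.app X).hom a = (hΦ X).weak.toRealification (Perfection.of _ a) := rfl

end RealificationData

end Literature.AlgebraicGeometry.Frobenioids

end
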